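import Summits.KontsevichZagierPeriods.KontsevichZagierPeriods.Theses.CobordismMove
import Literature.NumberTheory.Transcendental.KZLogCalculusProofs
import Literature.NumberTheory.Transcendental.KZUnfoldedStokesProofs
import Literature.NumberTheory.Transcendental.KZGroundingRelations

/-!
# `CubeLastNewtonLeibniz` (stmt-KontsevichZagierPeriods-17771, route CobordismMove) — proof

NEWTON–LEIBNIZ ALONG THE LAST COORDINATE OF THE OPEN UNIT CUBE, BULK TERM INCLUDED (piece P1 of the
typed decomposition `CubeLastNewtonLeibniz → CubeCoordinateCycle → ZeroCombination → CubeStokes` of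
the route's crux `CubeStokes`, stmt-KontsevichZagierPeriods-5566; it carries the analytic content):
for ONE coefficient `A`, `ℚ`-semialgebraic and continuous on the closed cube `[0,1]^(d+1)`, a
function `A'` with `HasDerivAt (s ↦ A (Fin.snoc y s)) (A' (Fin.snoc y t)) t` for `y` in the open
`d`-cube and `t ∈ (0,1)`, a bulk representation `R = [(0,1)^(d+1), A']` and face representations
`r₀ = [(0,1)^d, A(·,0)]`, `r₁ = [(0,1)^d, A(·,1)]`, the combination `[R] − [r₁] + [r₀]` lies in
`KZ.relations`.

Proof (a derivation in the fixed calculus): (1a) pass from the open cube to the closed-fibre band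
`B = {z | init z ∈ (0,1)^d ∧ 0 ≤ z last ≤ 1}` by domain additivity with the null faces
`{z last ∈ {0,1}}` (`KZ.of_mem_relations_of_volume_eq_zero`), extending the integrand by `0` off
the open cube (`IsSemialgebraicFunOn.union`); (3) ONE `newtonLeibnizRel` instance with base
`(0,1)^d`, `a = 0`, `b = 1`, primitive `F = A` (semialgebraic on `B ⊆ [0,1]^(d+1)` by `mono`,
continuous on the closed fibres, derivative = integrand on the open fibres) and base representation
`[(0,1)^d, A(·,1) − A(·,0)]`; (1b) split the difference into `r₁` and `−r₀` by integrand
additivity and `[σ, −f] + [σ, f] ∈ relations`.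

This is §3 of the crux strategist's complete sorry-free proof
`Summits/KontsevichZagierPeriods/KontsevichZagierPeriods/Cruxes/CubeStokes/CubeStokesProof.lean`
(seat planner-cstrat-stmt-KontsevichZagierPeriods-5566-r1-0, 2026-08-17), re-homed under `Theorems/`
by lead c10 of crux stmt-KontsevichZagierPeriods-9129 (banking): the helper lemmas verbatim, the
literal body of the item as `cubeLastNewtonLeibniz_holds`, and the closing theorem
`cubeLastNewtonLeibniz_proof : CubeLastNewtonLeibniz`. No definitions are introduced.

References: M. Kontsevich, D. Zagier, *Periods* (2001), §1.2, rules (1), (3) ("in several variables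
one replaces the Newton–Leibniz formula by Stokes's formula"); A. Huber, S. Müller-Stach, *Periods
and Nori Motives* (2017), §13.1; J. Bochnak, M. Coste, M.-F. Roy, *Real Algebraic Geometry* (1998),
§2.2.
-/

noncomputable section

open MeasureTheory Set
open Literature.NumberTheory.Transcendental
open Literature.ModelTheory.ExponentialFields (IsSemialgebraic)

namespace Summit.KontsevichZagierPeriods.CobordismMove

open Summit.KontsevichZagierPeriods.KontsevichZagierPeriods.Theses.CobordismMove

namespace CubeLastNewtonLeibniz

variable {d : ℕ}

/-! ### The open cubes, the band and its faces -/

/-- `t ↦ Fin.snoc x t` is continuous. [folklore] -/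
theorem continuous_snoc (x : Fin d → ℝ) :
    Continuous (fun t : ℝ => (Fin.snoc x t : Fin (d + 1) → ℝ)) := by
  refine continuous_pi fun i => ?_
  refine Fin.lastCases ?_ (fun j => ?_) i
  · simp only [Fin.snoc_last]
    exact continuous_id
  · simp only [Fin.snoc_castSucc]
    exact continuous_const

/-- A point of the open `d`-cube with a last coordinate in `(0,1)` is a point of the open
`(d+1)`-cube. [folklore] -/
theorem snoc_mem_setOf {x : Fin d → ℝ} (hx : x ∈ {y : Fin d → ℝ | ∀ i, y i ∈ Ioo (0 : ℝ) 1})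
    {t : ℝ} (ht : t ∈ Ioo (0 : ℝ) 1) :
    (Fin.snoc x t : Fin (d + 1) → ℝ) ∈ {z : Fin (d + 1) → ℝ | ∀ i, z i ∈ Ioo (0 : ℝ) 1} := by
  simp only [mem_setOf_eq] at hx ⊢
  intro i
  refine Fin.lastCases ?_ (fun j => ?_) i
  · simpa [Fin.snoc_last] using ht
  · simpa [Fin.snoc_castSucc] using hx j

/-- A point of the open `d`-cube with a last coordinate in `[0,1]` is a point of the closed
`(d+1)`-cube. [folklore] -/
theorem snoc_mem_Icc {x : Fin d → ℝ} (hx : x ∈ {y : Fin d → ℝ | ∀ i, y i ∈ Ioo (0 : ℝ) 1})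
    {t : ℝ} (ht : t ∈ Icc (0 : ℝ) 1) :
    (Fin.snoc x t : Fin (d + 1) → ℝ) ∈ Icc (0 : Fin (d + 1) → ℝ) 1 := by
  simp only [mem_setOf_eq] at hx
  rw [mem_Icc, Pi.le_def, Pi.le_def]
  constructor
  · intro i
    refine Fin.lastCases ?_ (fun j => ?_) i
    · simpa [Fin.snoc_last] using ht.1
    · simpa [Fin.snoc_castSucc] using (hx j).1.le
  · intro i
    refine Fin.lastCases ?_ (fun j => ?_) i
    · simpa [Fin.snoc_last] using ht.2
    · simpa [Fin.snoc_castSucc] using (hx j).2.le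

/-- The open `(d+1)`-cube lies in the closed-fibre band over the open `d`-cube. [folklore] -/
theorem setOf_subset_band :
    {z : Fin (d + 1) → ℝ | ∀ i, z i ∈ Ioo (0 : ℝ) 1} ⊆
      KZlog.band {y : Fin d → ℝ | ∀ i, y i ∈ Ioo (0 : ℝ) 1} (fun _ => 0) (fun _ => 1) := by
  intro z hz
  simp only [mem_setOf_eq] at hz
  refine ⟨fun j => hz (Fin.castSucc j), (hz (Fin.last d)).1.le, (hz (Fin.last d)).2.le⟩

/-- The closed-fibre band over the open `d`-cube lies in the closed `(d+1)`-cube. [folklore] -/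
theorem band_subset_Icc :
    KZlog.band {y : Fin d → ℝ | ∀ i, y i ∈ Ioo (0 : ℝ) 1} (fun _ => 0) (fun _ => 1) ⊆
      Icc (0 : Fin (d + 1) → ℝ) 1 := by
  intro z hz
  rw [KZlog.mem_band, mem_setOf_eq] at hz
  obtain ⟨hinit, h0, h1⟩ := hz
  rw [mem_Icc, Pi.le_def, Pi.le_def]
  constructor
  · intro i
    refine Fin.lastCases ?_ (fun j => ?_) i
    · simpa using h0
    · simpa [Fin.init] using (hinit j).1.le
  · intro i
    refine Fin.lastCases ?_ (fun j => ?_) i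
    · simpa using h1
    · simpa [Fin.init] using (hinit j).2.le

/-- The band minus the open cube lies in the two faces `{z last = 0} ∪ {z last = 1}`.
[folklore] -/
theorem band_diff_subset :
    KZlog.band {y : Fin d → ℝ | ∀ i, y i ∈ Ioo (0 : ℝ) 1} (fun _ => 0) (fun _ => 1) \
        {z : Fin (d + 1) → ℝ | ∀ i, z i ∈ Ioo (0 : ℝ) 1} ⊆
      {z : Fin (d + 1) → ℝ | z (Fin.last d) = 0} ∪ {z : Fin (d + 1) → ℝ | z (Fin.last d) = 1} := by
  rintro z ⟨hzB, hzU⟩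
  rw [KZlog.mem_band, mem_setOf_eq] at hzB
  obtain ⟨hinit, h0, h1⟩ := hzB
  simp only [mem_setOf_eq, not_forall] at hzU
  obtain ⟨i, hi⟩ := hzU
  simp only [mem_union, mem_setOf_eq]
  by_contra hcon
  push Not at hcon
  apply hi
  refine Fin.lastCases ?_ (fun j => ?_) i
  · exact ⟨lt_of_le_of_ne h0 (Ne.symm hcon.1), lt_of_le_of_ne h1 hcon.2⟩
  · exact hinit j

/-! ### The proof -/

/-- **`CubeLastNewtonLeibniz`, literal body** (stmt-KontsevichZagierPeriods-17771): Newton–Leibniz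
along the last coordinate of the open unit cube, bulk term included —
`[R] − [r₁] + [r₀] ∈ KZ.relations`. [cite: KontsevichZagier2001, §1.2 rule (3)] -/
theorem cubeLastNewtonLeibniz_holds :
    ∀ (d : ℕ) (A A' : (Fin (d + 1) → ℝ) → ℝ) (R : Literature.NumberTheory.Transcendental.KZ.IntegralRep (d + 1))
      (r₀ r₁ : Literature.NumberTheory.Transcendental.KZ.IntegralRep d),
      Literature.NumberTheory.Transcendental.IsSemialgebraicFunOn ℚ (Set.Icc (0 : Fin (d + 1) → ℝ) 1) A →
      ContinuousOn A (Set.Icc (0 : Fin (d + 1) → ℝ) 1) →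
      (∀ y ∈ {y : Fin d → ℝ | ∀ i, y i ∈ Set.Ioo (0 : ℝ) 1}, ∀ t ∈ Set.Ioo (0 : ℝ) 1,
        HasDerivAt (fun s : ℝ => A (Fin.snoc y s)) (A' (Fin.snoc y t)) t) →
      R.domain = {x : Fin (d + 1) → ℝ | ∀ i, x i ∈ Set.Ioo (0 : ℝ) 1} →
      Set.EqOn R.integrand A' R.domain →
      r₀.domain = {y : Fin d → ℝ | ∀ i, y i ∈ Set.Ioo (0 : ℝ) 1} →
      r₁.domain = {y : Fin d → ℝ | ∀ i, y i ∈ Set.Ioo (0 : ℝ) 1} →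
      Set.EqOn r₀.integrand (fun y => A (Fin.snoc y 0)) r₀.domain →
      Set.EqOn r₁.integrand (fun y => A (Fin.snoc y 1)) r₁.domain →
      Literature.NumberTheory.Transcendental.KZ.of R - Literature.NumberTheory.Transcendental.KZ.of r₁ +
        Literature.NumberTheory.Transcendental.KZ.of r₀ ∈ Literature.NumberTheory.Transcendental.KZ.relations := by
  intro d A A' R r₀ r₁ hA hcont hder hRd hRi hr₀d hr₁d hface₀ hface₁
  -- the cubes and the band
  have hUd : IsSemialgebraic ℚ {y : Fin d → ℝ | ∀ i, y i ∈ Ioo (0 : ℝ) 1} := KZ.isSemialgebraic_unitCube d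
  have hU : IsSemialgebraic ℚ {x : Fin (d + 1) → ℝ | ∀ i, x i ∈ Ioo (0 : ℝ) 1} :=
    KZ.isSemialgebraic_unitCube (d + 1)
  have hUdm : MeasurableSet {y : Fin d → ℝ | ∀ i, y i ∈ Ioo (0 : ℝ) 1} :=
    (KZ.isOpen_unitCube d).measurableSet
  have hUm : MeasurableSet R.domain := KZ.IntegralRep.measurableSet_domain_holds R
  have hB : IsSemialgebraic ℚ
      (KZlog.band {y : Fin d → ℝ | ∀ i, y i ∈ Ioo (0 : ℝ) 1} (fun _ => 0) (fun _ => 1)) :=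
    KZlog.isSemialgebraic_band (by simpa using isSemialgebraicFunOn_ratCast hUd 0)
      (by simpa using isSemialgebraicFunOn_ratCast hUd 1)
  have hT : IsSemialgebraic ℚ
      (KZlog.band {y : Fin d → ℝ | ∀ i, y i ∈ Ioo (0 : ℝ) 1} (fun _ => 0) (fun _ => 1) \ R.domain) := by
    rw [Set.sdiff_eq]
    exact hB.inter (hRd ▸ hU).compl
  have hUB : R.domain ⊆ KZlog.band {y : Fin d → ℝ | ∀ i, y i ∈ Ioo (0 : ℝ) 1} (fun _ => 0) (fun _ => 1) := by
    rw [hRd]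
    exact setOf_subset_band
  -- (1a) the integrand of `R` extended by zero, an honest representation on the band
  have hgsa : IsSemialgebraicFunOn ℚ
      (KZlog.band {y : Fin d → ℝ | ∀ i, y i ∈ Ioo (0 : ℝ) 1} (fun _ => 0) (fun _ => 1))
      (R.domain.indicator R.integrand) := by
    have h := IsSemialgebraicFunOn.union R.isSemialgebraicFunOn_integrand
      (isSemialgebraicFunOn_ratCast hT 0) (F := R.domain.indicator R.integrand)
      (fun x hx => Set.indicator_of_mem hx _) (fun x hx => by
        rw [Set.indicator_of_notMem hx.2]
        simp)
    rwa [Set.union_sdiff_cancel hUB] at h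
  have hgint : IntegrableOn (R.domain.indicator R.integrand)
      (KZlog.band {y : Fin d → ℝ | ∀ i, y i ∈ Ioo (0 : ℝ) 1} (fun _ => 0) (fun _ => 1)) :=
    ((integrable_indicator_iff hUm).2 R.integrableOn).integrableOn
  have hRbex : ∃ Rb : KZ.IntegralRep (d + 1),
      Rb.domain = KZlog.band {y : Fin d → ℝ | ∀ i, y i ∈ Ioo (0 : ℝ) 1} (fun _ => 0) (fun _ => 1) ∧
        Rb.integrand = R.domain.indicator R.integrand :=
    ⟨⟨_, _, hB, hgsa, hgint⟩, rfl, rfl⟩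
  obtain ⟨Rb, hRbd, hRbi⟩ := hRbex
  have hNtex : ∃ Nt : KZ.IntegralRep (d + 1),
      Nt.domain = KZlog.band {y : Fin d → ℝ | ∀ i, y i ∈ Ioo (0 : ℝ) 1} (fun _ => 0) (fun _ => 1) \ R.domain ∧
        Nt.integrand = R.domain.indicator R.integrand :=
    ⟨⟨_, _, hT, hgsa.mono Set.sdiff_subset hT, hgint.mono_set Set.sdiff_subset⟩, rfl, rfl⟩
  obtain ⟨Nt, hNtd, hNti⟩ := hNtex
  have h1a : KZ.of Rb - KZ.of R - KZ.of Nt ∈ KZ.relations := by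
    refine KZ.domainAddRel_subset_relations ⟨d + 1, Rb, R, Nt, ?_, ?_, ?_, ?_, rfl⟩
    · rw [hRbd, hNtd, Set.union_sdiff_cancel hUB]
    · rw [hNtd, Set.inter_sdiff_self, measure_empty]
    · intro x hx
      rw [hRbi, Set.indicator_of_mem hx]
    · intro x _
      rw [hRbi, hNti]
  have hNt : KZ.of Nt ∈ KZ.relations := by
    refine KZ.of_mem_relations_of_volume_eq_zero Nt ?_
    rw [hNtd]
    refine measure_mono_null ?_
      (measure_union_null (KZ.volume_setOf_last_eq_zero (n := d) 0) (KZ.volume_setOf_last_eq_zero (n := d) 1))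
    rw [hRd]
    exact band_diff_subset
  -- (3) the base representation `[(0,1)^d, A(·,1) − A(·,0)]` and the Newton–Leibniz instance
  have hA1sa : IsSemialgebraicFunOn ℚ {y : Fin d → ℝ | ∀ i, y i ∈ Ioo (0 : ℝ) 1}
      (fun y => A (Fin.snoc y 1)) := by
    have h := r₁.isSemialgebraicFunOn_integrand
    rw [hr₁d] at h
    exact h.congr fun y hy => hface₁ (by rw [hr₁d]; exact hy)
  have hA0sa : IsSemialgebraicFunOn ℚ {y : Fin d → ℝ | ∀ i, y i ∈ Ioo (0 : ℝ) 1}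
      (fun y => A (Fin.snoc y 0)) := by
    have h := r₀.isSemialgebraicFunOn_integrand
    rw [hr₀d] at h
    exact h.congr fun y hy => hface₀ (by rw [hr₀d]; exact hy)
  have hDsa : IsSemialgebraicFunOn ℚ {y : Fin d → ℝ | ∀ i, y i ∈ Ioo (0 : ℝ) 1}
      (fun y => A (Fin.snoc y 1) - A (Fin.snoc y 0)) :=
    (IsSemialgebraicFunOn.sub_holds hA1sa hA0sa).congr fun _ _ => rfl
  have hA1int : IntegrableOn (fun y => A (Fin.snoc y 1)) {y : Fin d → ℝ | ∀ i, y i ∈ Ioo (0 : ℝ) 1} := by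
    have h := r₁.integrableOn
    rw [hr₁d] at h
    exact h.congr_fun (fun y hy => hface₁ (by rw [hr₁d]; exact hy)) hUdm
  have hA0int : IntegrableOn (fun y => A (Fin.snoc y 0)) {y : Fin d → ℝ | ∀ i, y i ∈ Ioo (0 : ℝ) 1} := by
    have h := r₀.integrableOn
    rw [hr₀d] at h
    exact h.congr_fun (fun y hy => hface₀ (by rw [hr₀d]; exact hy)) hUdm
  have hrDex : ∃ rD : KZ.IntegralRep d, rD.domain = {y : Fin d → ℝ | ∀ i, y i ∈ Ioo (0 : ℝ) 1} ∧
      rD.integrand = fun y => A (Fin.snoc y 1) - A (Fin.snoc y 0) :=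
    ⟨⟨_, _, hUd, hDsa, hA1int.sub hA0int⟩, rfl, rfl⟩
  obtain ⟨rD, hrDd, hrDi⟩ := hrDex
  have h3 : KZ.of Rb - KZ.of rD ∈ KZ.relations := by
    refine KZ.newtonLeibnizRel_subset_relations ⟨d, Rb, rD, fun _ => 0, fun _ => 1, A, ?_, ?_, ?_,
      fun _ _ => zero_le_one, ?_, ?_, ?_, ?_, rfl⟩
    · rw [hRbd]
      exact hA.mono band_subset_Icc hB
    · simpa using isSemialgebraicFunOn_ratCast rD.isSemialgebraic_domain 0
    · simpa using isSemialgebraicFunOn_ratCast rD.isSemialgebraic_domain 1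
    · rw [hRbd, hrDd]
      rfl
    · intro x hx
      rw [hrDd] at hx
      exact hcont.comp (continuous_snoc x).continuousOn fun t ht => snoc_mem_Icc hx ht
    · intro x hx t ht
      rw [hrDd] at hx
      have hmem : (Fin.snoc x t : Fin (d + 1) → ℝ) ∈ R.domain := by
        rw [hRd]
        exact snoc_mem_setOf hx ht
      refine (hder x hx t ht).congr_deriv ?_
      rw [hRbi, Set.indicator_of_mem hmem]
      exact (hRi hmem).symm
    · intro x _
      rw [hrDi]
  -- (1b) split the base representation into the two faces
  have h1b : KZ.of rD - KZ.of r₁ - KZ.of r₀.neg ∈ KZ.relations := by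
    refine KZ.integrandAddRel_subset_relations ⟨d, rD, r₁, r₀.neg, by rw [hr₁d, hrDd],
      by rw [KZ.IntegralRep.domain_neg, hr₀d, hrDd], fun y hy => ?_, rfl⟩
    rw [hrDd] at hy
    rw [hrDi, Pi.add_apply, KZ.IntegralRep.integrand_neg, Pi.neg_apply,
      hface₁ (by rw [hr₁d]; exact hy), hface₀ (by rw [hr₀d]; exact hy)]
    ring
  have hneg : KZ.of r₀.neg + KZ.of r₀ ∈ KZ.relations := by
    have h := KZ.of_add_of_mem_relations_of_eqOn_neg (r := r₀) (r' := r₀.neg)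
      (KZ.IntegralRep.domain_neg r₀) (fun x _ => by rw [KZ.IntegralRep.integrand_neg])
    rwa [add_comm] at h
  -- collect
  have key : KZ.of R - KZ.of r₁ + KZ.of r₀ =
      -(KZ.of Rb - KZ.of R - KZ.of Nt) - KZ.of Nt + (KZ.of Rb - KZ.of rD) +
        (KZ.of rD - KZ.of r₁ - KZ.of r₀.neg) + (KZ.of r₀.neg + KZ.of r₀) := by
    abel
  rw [key]
  exact KZ.relations.add_mem (KZ.relations.add_mem (KZ.relations.add_mem (KZ.relations.sub_mem
    (KZ.relations.neg_mem h1a) hNt) h3) h1b) hneg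

/-- **Settles stmt-KontsevichZagierPeriods-17771 (`CubeLastNewtonLeibniz`)**: the route declaration
`Summit.KontsevichZagierPeriods.KontsevichZagierPeriods.Theses.CobordismMove.CubeLastNewtonLeibniz`,
concluded by name from its literal body `cubeLastNewtonLeibniz_holds`.
[cite: KontsevichZagier2001, §1.2 rule (3)] -/
theorem cubeLastNewtonLeibniz_proof : CubeLastNewtonLeibniz :=
  cubeLastNewtonLeibniz_holds

end CubeLastNewtonLeibniz

end Summit.KontsevichZagierPeriods.CobordismMove
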